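import Mathlib.FieldTheory.SeparableClosure
import Mathlib.FieldTheory.IsAlgClosed.AlgebraicClosure
import Mathlib.FieldTheory.PrimitiveElement
import Mathlib.Algebra.Polynomial.Lifts
import HarnessLib

/-!
# Separably closed base fields: irreducible separable polynomials stay irreducible, and
# `[L₁·K₂ : K₂] = [L₁ : K₁]` for finite separable `L₁/K₁`

Let `K₁ ⊆ K₂` be a field extension in which `K₁` is **separably closed** (every element of `K₂` that
is separable algebraic over `K₁` lies in `K₁`; no hypothesis on transcendence degree or
characteristic). Classical facts (S. Lang, *Algebra*, 3rd ed., VIII §4 on regular and separable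
extensions; M. Fried – M. Jarden, *Field Arithmetic*, 3rd ed., §2.6 "linear disjointness", Lemma 2.6.7
and Cor. 2.6.8 in the separable form):

* `Literature.FieldTheory.Regular.isSeparable_coeff_of_monic_dvd_map` — the coefficients of a monic
  factor over `K₂` of a SEPARABLE polynomial over `K₁` are separable algebraic over `K₁` (they are
  elementary symmetric functions of separable roots);
* `Literature.FieldTheory.Regular.irreducible_map_of_isSepClosedIn` — hence an irreducible separable
  polynomial over `K₁` stays irreducible over `K₂` (the separable sharpening of the tree's
  `irreducible_map_of_isAlgClosedIn`, `RegularExtension.lean`, which needs `K₁` ALGEBRAICALLY closed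
  in `K₂`);
* `Literature.FieldTheory.Regular.minpoly_map_eq_of_isSepClosedIn` — for `θ` separable algebraic over
  `K₁` in any common overfield `E ⊇ K₂`, `minpoly_{K₂} θ = minpoly_{K₁} θ`;
  `Literature.FieldTheory.Regular.finrank_adjoin_simple_eq_of_isSepClosedIn` — `[K₂(θ) : K₂] = [K₁(θ) : K₁]`;
* `Literature.FieldTheory.Regular.finrank_adjoin_eq_of_isSepClosedIn` — for a finite separable
  intermediate field `L₁` of `E/K₁`: `[K₂·L₁ : K₂] = [L₁ : K₁]` (primitive element).

This is the field-theoretic step of the proof of [FrdI] Theorem 6.2 (i) (S. Mochizuki, *The geometry of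
Frobenioids I*, Kyushu J. Math. 62 (2008), kurims text p. 111 l. 23–28): "by assumptions (b), (c) [`K₁`
separably closed in `K₂`], it follows that any finite extension `L₁ ⊆ K̃₁` of `K₁` determines a finite
extension `L₂ := L₁ · K₂ ⊆ K̃₂` of `K₂` such that `[L₂ : K₂] = [L₁ : K₁]`" (sub-DAG W5, row "compositum
degree", cell abc-iut layer L1). Mathlib has the purely-inseparable-base case
(`IntermediateField.linearDisjoint_of_isPurelyInseparable_of_isSeparable`) but not the separably-closed
case, where `K₂/K₁` may be transcendental (function fields). Mathlib + HarnessLib only.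
-/

open Polynomial
open scoped IntermediateField

namespace Literature.FieldTheory.Regular

/-! ### Coefficients of monic factors of separable polynomials are separable -/

/-- The coefficients of a monic factor `q ∈ K[X]` of (the image of) a separable polynomial `h ∈ L[X]`
are separable algebraic over `L`: over an algebraic closure `q = ∏ (X − α)` with every `α` a root of
`h`, hence separable over `L`, so the coefficients lie in the relative separable closure of `L`.
[cite: Lang2002, VIII §4] -/
theorem isSeparable_coeff_of_monic_dvd_map {L K : Type*} [Field L] [Field K] [Algebra L K]
    {h : L[X]} (hsep : h.Separable) {q : K[X]} (hq : q.Monic)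
    (hqd : q ∣ h.map (algebraMap L K)) (n : ℕ) : IsSeparable L (q.coeff n) := by
  classical
  let Ω := AlgebraicClosure K
  set qΩ : Ω[X] := q.map (algebraMap K Ω) with hqΩ_def
  have hqΩm : qΩ.Monic := hq.map _
  have hsplit : qΩ.Splits := IsAlgClosed.splits qΩ
  -- every root of `q` in `Ω` is a root of `h`, hence separable over `L`
  have hdvd : qΩ ∣ h.map (algebraMap L Ω) := by
    have h1 := Polynomial.map_dvd (algebraMap K Ω) hqd
    rwa [Polynomial.map_map, ← IsScalarTower.algebraMap_eq L K Ω] at h1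
  have hroot : ∀ α ∈ qΩ.roots, α ∈ (algebraMap (separableClosure L Ω) Ω).range := by
    intro α hα
    have hα0 : qΩ.IsRoot α := (Polynomial.mem_roots hqΩm.ne_zero).1 hα
    have hhα : Polynomial.aeval α h = 0 := by
      obtain ⟨r, hr⟩ := hdvd
      rw [Polynomial.aeval_def, Polynomial.eval₂_eq_eval_map, hr, Polynomial.eval_mul, hα0.eq_zero,
        zero_mul]
    have hαsep : IsSeparable L α := hsep.of_dvd (minpoly.dvd L α hhα)
    exact ⟨⟨α, mem_separableClosure_iff.2 hαsep⟩, rfl⟩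
  -- so `q` has coefficients in the relative separable closure of `L` in `Ω`
  have hlift : qΩ ∈ Polynomial.lifts (algebraMap (separableClosure L Ω) Ω) :=
    hsplit.mem_lift_of_roots_mem_range hqΩm _ hroot
  obtain ⟨s, hs⟩ := (Polynomial.lifts_iff_coeff_lifts _).1 hlift n
  have hsS : IsSeparable L (s : Ω) := mem_separableClosure_iff.1 s.2
  have hcoeff : (algebraMap K Ω) (q.coeff n) = (s : Ω) := by
    rw [← Polynomial.coeff_map, ← hqΩ_def, ← hs]
    rfl
  have : IsSeparable L (algebraMap K Ω (q.coeff n)) := hcoeff ▸ hsS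
  exact this.tower_bot

/-! ### Irreducible separable polynomials stay irreducible over a separably-closed-base extension -/

/-- If `L` is SEPARABLY closed in `K` (every element of `K` separable algebraic over `L` lies in `L`),
a monic irreducible separable polynomial over `L` stays irreducible over `K`: the coefficients of a
monic factor over `K` are separable algebraic over `L` (`isSeparable_coeff_of_monic_dvd_map`), hence lie
in `L`, so the factorisation descends to `L` (the argument of the tree's `irreducible_map_of_isAlgClosedIn`
with "integral" sharpened to "separable algebraic"). [cite: Lang2002, VIII §4] -/
theorem irreducible_map_of_isSepClosedIn {L K : Type*} [Field L] [Field K] [Algebra L K]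
    (hsc : ∀ z : K, IsSeparable L z → z ∈ Set.range (algebraMap L K)) {h : L[X]} (hm : h.Monic)
    (hirr : Irreducible h) (hsep : h.Separable) : Irreducible (h.map (algebraMap L K)) := by
  have hmK : (h.map (algebraMap L K)).Monic := hm.map _
  rw [hmK.irreducible_iff_natDegree]
  refine ⟨fun h1 => ?_, fun f g hf hg hfg => ?_⟩
  · have h1' := congrArg Polynomial.natDegree h1
    rw [hm.natDegree_map, Polynomial.natDegree_one] at h1'
    have hpos := Polynomial.degree_pos_of_irreducible hirr
    rw [Polynomial.degree_eq_natDegree hirr.ne_zero, h1'] at hpos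
    exact lt_irrefl _ hpos
  · -- descend the monic factors to `L`
    have lifts : ∀ q : K[X], q.Monic → q ∣ h.map (algebraMap L K) →
        ∃ q₀ : L[X], q₀.map (algebraMap L K) = q ∧ q₀.Monic := by
      intro q hq hqd
      have hl : q ∈ Polynomial.lifts (algebraMap L K) := by
        rw [Polynomial.lifts_iff_coeff_lifts]
        intro n
        exact hsc _ (isSeparable_coeff_of_monic_dvd_map hsep hq hqd n)
      obtain ⟨q₀, hq₀, -, hq₀m⟩ := Polynomial.lifts_and_natDegree_eq_and_monic hl hq
      exact ⟨q₀, hq₀, hq₀m⟩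
    obtain ⟨f₀, hf₀, hf₀m⟩ := lifts f hf ⟨g, hfg.symm⟩
    obtain ⟨g₀, hg₀, hg₀m⟩ := lifts g hg ⟨f, by rw [mul_comm]; exact hfg.symm⟩
    have hprod : f₀ * g₀ = h := Polynomial.map_injective _ (algebraMap L K).injective
      (by rw [Polynomial.map_mul, hf₀, hg₀, hfg])
    rcases ((hm.irreducible_iff_natDegree).1 hirr).2 f₀ g₀ hf₀m hg₀m hprod with h0 | h0
    · left; rw [← hf₀, hf₀m.natDegree_map, h0]
    · right; rw [← hg₀, hg₀m.natDegree_map, h0]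

/-- "`L` is separably closed in `K`" in terms of Mathlib's relative separable closure:
`separableClosure L K = ⊥` gives the hypothesis of `irreducible_map_of_isSepClosedIn`. [cite: Lang2002, VIII §4] -/
theorem isSepClosedIn_of_separableClosure_eq_bot {L K : Type*} [Field L] [Field K] [Algebra L K]
    (h : separableClosure L K = ⊥) (z : K) (hz : IsSeparable L z) :
    z ∈ Set.range (algebraMap L K) := by
  have hz' : z ∈ separableClosure L K := mem_separableClosure_iff.2 hz
  rw [h, IntermediateField.mem_bot] at hz'
  exact hz'

/-! ### Minimal polynomials and degrees of simple extensions do not change -/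

section Tower

variable {L K E : Type*} [Field L] [Field K] [Field E] [Algebra L K] [Algebra K E] [Algebra L E]
  [IsScalarTower L K E]

/-- Over a separably-closed-base extension `K/L`, the minimal polynomial over `K` of an element `θ`
(of any common overfield `E`) that is separable algebraic over `L` IS its minimal polynomial over `L`.
[cite: Lang2002, VIII §4] -/
theorem minpoly_map_eq_of_isSepClosedIn
    (hsc : ∀ z : K, IsSeparable L z → z ∈ Set.range (algebraMap L K)) {θ : E} (hθ : IsSeparable L θ) :
    (minpoly L θ).map (algebraMap L K) = minpoly K θ := by
  have hint : IsIntegral L θ := hθ.isIntegral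
  refine minpoly.eq_of_irreducible_of_monic
    (irreducible_map_of_isSepClosedIn hsc (minpoly.monic hint) (minpoly.irreducible hint) hθ) ?_
    ((minpoly.monic hint).map _)
  rw [Polynomial.aeval_map_algebraMap, minpoly.aeval]

/-- Hence `[K(θ) : K] = [L(θ) : L]` for `θ` separable algebraic over `L` ([FrdI] Thm. 6.2 (i), proof,
p. 111 l. 23–28, the case of a simple extension `L₁ = L(θ)`). [cite: Lang2002, VIII §4] -/
theorem finrank_adjoin_simple_eq_of_isSepClosedIn
    (hsc : ∀ z : K, IsSeparable L z → z ∈ Set.range (algebraMap L K)) {θ : E} (hθ : IsSeparable L θ) :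
    Module.finrank K K⟮θ⟯ = Module.finrank L L⟮θ⟯ := by
  have hint : IsIntegral L θ := hθ.isIntegral
  have hintK : IsIntegral K θ := hint.tower_top
  rw [IntermediateField.adjoin.finrank hintK, IntermediateField.adjoin.finrank hint,
    ← minpoly_map_eq_of_isSepClosedIn hsc hθ, (minpoly.monic hint).natDegree_map]

/-- The compositum `K · L(θ)` inside `E` is `K(θ)`. [folklore] -/
private theorem adjoin_adjoin_simple_eq (θ : E) :
    IntermediateField.adjoin K ((L⟮θ⟯ : IntermediateField L E) : Set E) = K⟮θ⟯ := by
  apply le_antisymm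
  · rw [IntermediateField.adjoin_le_iff]
    change ((L⟮θ⟯ : IntermediateField L E) : Set E) ⊆ ((K⟮θ⟯.restrictScalars L : IntermediateField L E) : Set E)
    rw [SetLike.coe_subset_coe, IntermediateField.adjoin_le_iff]
    exact Set.singleton_subset_iff.2 (IntermediateField.mem_adjoin_simple_self K θ)
  · exact IntermediateField.adjoin.mono K _ _
      (Set.singleton_subset_iff.2 (IntermediateField.mem_adjoin_simple_self L θ))

/-- **`[L₁ · K₂ : K₂] = [L₁ : K₁]`** ([FrdI] Thm. 6.2 (i), proof, kurims p. 111 l. 23–28: "any finite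
extension `L₁ ⊆ K̃₁` of `K₁` determines a finite extension `L₂ := L₁ · K₂ ⊆ K̃₂` of `K₂` such that
`[L₂ : K₂] = [L₁ : K₁]`", `K̃₁/K₁` being Galois so that `L₁/K₁` is separable): for `K₁ = L` separably closed
in `K₂ = K` and a finite separable intermediate field `L₁` of a common overfield `E/L`, the compositum
`K · L₁ ⊆ E` has degree `[L₁ : L]` over `K`. [cite: MochizukiFrdI2008, Thm. 6.2 (i) p.111]
[cite: Lang2002, VIII §4] -/
theorem finrank_adjoin_eq_of_isSepClosedIn
    (hsc : ∀ z : K, IsSeparable L z → z ∈ Set.range (algebraMap L K))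
    (L₁ : IntermediateField L E) [FiniteDimensional L L₁] [Algebra.IsSeparable L L₁] :
    Module.finrank K (IntermediateField.adjoin K (L₁ : Set E)) = Module.finrank L L₁ := by
  obtain ⟨α, hα⟩ := Field.exists_primitive_element L L₁
  have hL₁ : L₁ = L⟮(α : E)⟯ := by
    rw [← IntermediateField.lift_adjoin_simple (K := L₁) (α := α), hα,
      IntermediateField.lift_top (K := L₁)]
  have hαsep : IsSeparable L (α : E) :=
    IsSeparable.map (IntermediateField.val L₁) (IntermediateField.val L₁).injective
      (Algebra.IsSeparable.isSeparable L α)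
  have e1 : Module.finrank L L₁ = Module.finrank L L⟮(α : E)⟯ := by
    conv_lhs => rw [hL₁]
  have e2 : IntermediateField.adjoin K (L₁ : Set E) = K⟮(α : E)⟯ := by
    conv_lhs => rw [hL₁]
    exact adjoin_adjoin_simple_eq (L := L) (α : E)
  rw [e1, e2]
  exact finrank_adjoin_simple_eq_of_isSepClosedIn hsc hαsep

end Tower

end Literature.FieldTheory.Regular
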